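import Literature.Topology.PlanarFoliations.ZoneSack
import Literature.Topology.PlanarFoliations.SpiralHugging
import Literature.Topology.PlanarFoliations.Regions
import Literature.Topology.PlanarFoliations.Kneser
import HarnessLib

/-!
# No inner leaf accumulates on a terminal essential pattern

Topic: Topology / PlanarFoliations, sequel to `ZoneSack.lean`, `SackTrap.lean` (sacks, sides,
trapped leaves), `SpiralHugging.lean` (an open leaf accumulating on a line leaf hugs an essential
simple polygon, with an invariant of its separatrices), `Regions.lean` (a compact leaf in a limit
set is essential), `LimitSets.lean`. The setting is a **terminal zone**: a Jordan loop `γ` whose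
trace is made of punctures and leaves (`hsat`), inside a compact `C ⊆ Ω`, such that every compact
leaf inside `γ` off the trace is image-null (`hcpt`) and every simple separatrix polygon with
separatrices in the fill of `γ` and essential leaf loop has its separatrices on the trace
(`hpoly`) — the fill of a terminal essential polygon or compact leaf of the minimiser scheme.
**Then no open leaf inside `γ` accumulates on a point of the domain on the trace of `γ`**
(`not_mem_omegaSet_of_zone`; the α-version `not_mem_alphaSet_of_zone`).

Proof (Camacho–Lins Neto, Ch. VII §2, the argument for Prop. 3 and for the minimal element): read the
trace point `xk` in a flow box in which the trace is the plaque (`hloc`); the inside is on one side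
(`exists_oneSided`), so the crossings of `L` accumulate at the height of `xk` from that side. For a
height `t` on that side below a reference crossing and off countably many heights, two crossings of
`L` successive in the height window of `t` give a sack with `t` strictly inside and `ι xk` in the
right side (`exists_sack`); the leaf `L_t` through the vertical point at height `t` is open
(`FrontierLeaves`), inside `γ`, trapped: its α-limit set lies in the closure of the left side. That
α-limit set cannot consist of punctures (then `L_t` is a level leaf and `t` one of countably many
heights), cannot contain a compact leaf (essential by `Regions`, image-null by `hcpt`), and cannot
contain a point of a line leaf: hugging (`exists_polyCycle_of_mem_limGraph`) gives an essential
polygon with separatrices in the left side (the invariant), yet on the trace of `γ` (`hpoly`),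
which is in the right side.

## References

* C. Camacho, A. Lins Neto, *Geometric Theory of Foliations*, Birkhäuser (1985), Ch. VII §2
  [CamachoLinsNeto1985].
-/

noncomputable section

open Set Filter Function Metric
open _root_.Topology
open Literature.Topology.FourManifolds Literature.Topology.FourManifolds.Foliation Literature.Topology.PlaneTopology

namespace Literature.Topology.PlanarFoliations

variable {X : Type*} [TopologicalSpace X] [T2Space X] [SecondCountableTopology X] [Nonempty X] {F : Foliation ℝ X} {ι : X → ℂ}
variable {B : Type*} [NormedAddCommGroup B] [NormedSpace ℝ B] [LocallyConnectedSpace B] {M : Type*} [TopologicalSpace M]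
  {T : Foliation B M} {g : ℂ → M}

namespace StarData

variable (D : StarData F ι T g) (hbi : IsBiOriented F) (hι : IsOpenEmbedding ι) (ho : F.IsTransverselyOriented)
  {C : Set ℂ} (hC : IsCompact C) (hCΩ : C ⊆ D.Ω)
  {γ : ℝ → ℂ} (hJ : IsJordanLoop γ) (hγC : IsJordanLoop.fill γ ⊆ C)
  (hsat : ∀ x', ι x' ∈ range γ → ∀ x'' ∈ F.leaf x', ι x'' ∈ range γ)
  (hcpt : ∀ y', IsCompact (F.leaf y') → ι '' F.leaf y' ⊆ IsJordanLoop.fill γ →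
    Disjoint (ι '' F.leaf y') (range γ) → ImageNull D.foliated y')
  (hpoly : ∀ Q : D.PolyCycle hbi C, (∀ i (q : F.Leaf (Q.sx i)), ι (Leaf.pt q) ∈ IsJordanLoop.fill γ) →
    ¬ (Q.leafLoop hι hC).Homotopic (Path.refl _) → ∀ i (q : F.Leaf (Q.sx i)), ι (Leaf.pt q) ∈ range γ)
  {y₀ : X} [NoncompactSpace (F.Leaf y₀)] (hLU : ι '' F.leaf y₀ ⊆ IsJordanLoop.inside γ)
  {xk : X} (hk : ι xk ∈ range γ) {e : OpenPartialHomeomorph X (ℝ × ℝ)} (he : e ∈ F.atlas) (hxke : xk ∈ e.source)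
  (hloc : ∃ ε > 0, ∀ x', ι x' ∈ range γ → x' ∈ e.source →
    |(e x').1 - (e xk).1| < ε → |(e x').2 - (e xk).2| < ε → (e x').2 = (e xk).2)

/-! ## Crossings of inner leaves are on the inner side -/

include hk hxke in
omit [T2Space X] [SecondCountableTopology X] [Nonempty X] in
/-- **A leaf inside `γ` crosses the vertical of `xk` near it on the inner side.** [folklore] -/
theorem sign_of_isCrossing {s ε : ℝ} (hs : s = 1 ∨ s = -1) (hε : 0 < ε)
    (hout : ∀ u t, |u - (e xk).1| < ε → |t - (e xk).2| < ε → 0 < -s * (t - (e xk).2) → ι (e.symm (u, t)) ∉ IsJordanLoop.inside γ)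
    {y : X} (hyU : ι '' F.leaf y ⊆ IsJordanLoop.inside γ) (q : F.Leaf y) (hq : IsCrossing e (e xk).1 q)
    (hnear : |ht e q - (e xk).2| < ε) : 0 < s * (ht e q - (e xk).2) := by
  have hpt : Leaf.pt q = e.symm ((e xk).1, ht e q) := hq.pt_eq
  have hin : ι (e.symm ((e xk).1, ht e q)) ∈ IsJordanLoop.inside γ := hyU ⟨Leaf.pt q, q.2, by rw [hpt]⟩
  have hu : |(e xk).1 - (e xk).1| < ε := by rw [sub_self, abs_zero]; exact hε
  rcases lt_trichotomy (ht e q) (e xk).2 with h | h | h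
  · rcases hs with rfl | rfl
    · exact absurd hin (hout _ _ hu hnear (by linarith))
    · linarith
  · -- on the plaque of `xk`: the crossing point is `xk`, inside and on the trace
    exfalso
    have hxk : e.symm ((e xk).1, ht e q) = xk := by
      rw [h]; show e.symm (e xk) = xk; exact e.left_inv hxke
    rw [hxk] at hin
    exact hin.1 hk
  · rcases hs with rfl | rfl
    · linarith
    · exact absurd hin (hout _ _ hu hnear (by linarith))

/-! ## The sack of a good height -/

section Sack

variable {s ε₁ : ℝ} (hs : s = 1 ∨ s = -1) (hε₁ : 0 < ε₁)
  (hin : ∀ u t, |u - (e xk).1| < ε₁ → |t - (e xk).2| < ε₁ → 0 < s * (t - (e xk).2) → ι (e.symm (u, t)) ∈ IsJordanLoop.inside γ)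
  (hsignL : ∀ q : F.Leaf y₀, IsCrossing e (e xk).1 q → |ht e q - (e xk).2| < ε₁ → 0 < s * (ht e q - (e xk).2))
  {c₁ : F.Leaf y₀} (hc₁ : IsCrossing e (e xk).1 c₁) (hc₁ε : |ht e c₁ - (e xk).2| < ε₁)
  {t : ℝ} (ht0 : 0 < s * (t - (e xk).2)) (ht1 : s * (t - (e xk).2) < s * (ht e c₁ - (e xk).2))
  (htL : t ∉ F.leafHeights e y₀)

include hι hk hLU he hxke hs hsignL hc₁ hc₁ε ht0 ht1 htL in
omit [Nonempty X] in
/-- **The sack of a good height** (ω-version). If `ι xk ∈ ω(L)`, for a height `t` on the inner side,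
closer to the height of `xk` than the reference crossing `c₁` and not a leaf height of `L`, two
crossings of `L` successive in the height window give a sack with `t` strictly between their
heights, the whole height interval on the inner side within `ε₁`, and `ι xk` in the right side.
[cite: CamachoLinsNeto1985, Ch. VII §2] -/
theorem exists_sack (hω : ι xk ∈ omegaSet hbi ι y₀) :
    ∃ Dk : SackData hbi y₀ e (e xk).1, t ∈ Ioo Dk.tlo Dk.thi ∧
      (∀ h ∈ Icc Dk.tlo Dk.thi, 0 < s * (h - (e xk).2) ∧ |h - (e xk).2| < ε₁) ∧ ι xk ∈ Dk.rightSide he ι := by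
  set u₀ := (e xk).1 with hu₀
  set tk := (e xk).2 with htk
  have habs : ∀ h : ℝ, 0 < s * (h - tk) → |h - tk| = s * (h - tk) := fun h hh ↦ by
    rcases hs with rfl | rfl
    · rw [one_mul] at hh ⊢; exact abs_of_pos hh
    · rw [neg_one_mul] at hh ⊢; exact abs_of_neg (by linarith)
  have hxk : e.symm (u₀, tk) = xk := by rw [show (u₀, tk) = e xk from rfl, e.left_inv hxke]
  have hωv : ι (e.symm (u₀, tk)) ∈ omegaSet hbi ι y₀ := by rw [hxk]; exact hω
  have hc₁pos := hsignL c₁ hc₁ hc₁ε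
  set ε₂ := s * (ht e c₁ - tk) with hε₂
  have hε₂abs : |ht e c₁ - tk| = ε₂ := habs _ hc₁pos
  have hne₁ : ht e c₁ ≠ tk := fun h ↦ by
    have := hc₁pos; rw [hε₂, h, sub_self, mul_zero] at this; exact lt_irrefl _ this
  -- the height windows
  set Tset : Set ℝ := {h | 0 ≤ s * (h - tk) ∧ s * (h - tk) ≤ s * (t - tk)} with hTset
  set Wset : Set ℝ := {h | 0 ≤ s * (h - tk) ∧ s * (h - tk) ≤ ε₂} with hWset
  have hcf : Continuous fun h : ℝ ↦ s * (h - tk) := by fun_prop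
  have hTc : IsClosed Tset := (isClosed_le continuous_const hcf).inter (isClosed_le hcf continuous_const)
  have hWc : IsClosed Wset := (isClosed_le continuous_const hcf).inter (isClosed_le hcf continuous_const)
  have hbdd : ∀ {S : Set ℝ}, S ⊆ {h | 0 ≤ s * (h - tk) ∧ s * (h - tk) ≤ ε₂} → Bornology.IsBounded S := fun {S} hS ↦
    (Metric.isBounded_Icc (tk - ε₂) (tk + ε₂)).subset fun h hh ↦ by
      obtain ⟨h1, h2⟩ := hS hh
      rcases hs with rfl | rfl
      · constructor <;> linarith
      · constructor <;> linarith
  have hTW : Tset ⊆ Wset := fun h hh ↦ ⟨hh.1, hh.2.trans ht1.le⟩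
  have hTb : Bornology.IsBounded Tset := hbdd hTW
  have hWb : Bornology.IsBounded Wset := hbdd Subset.rfl
  -- a crossing after `c₁` with height in `Tset`
  obtain ⟨c, hc₁c, hc, hcnear⟩ := exists_crossing_near (hbi := hbi) he hι hωv hc₁ hne₁ ht0 (by rw [hε₂abs]; exact ht1.le)
  have hcpos : 0 < s * (ht e c - tk) := hsignL c hc (hcnear.trans (ht1.trans (by rw [← hε₂abs]; exact hc₁ε)))
  have hcT : ht e c ∈ Tset := ⟨hcpos.le, by
    have := habs _ hcpos; rw [this] at hcnear; exact hcnear.le⟩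
  -- the first crossing `q₂` after `c₁` with height in `Tset`
  obtain ⟨q₂, hc₁q₂, -, hq₂, hq₂T, hfirst⟩ := exists_first_crossing (hbi := hbi) he hTc hTb hc₁c hc hcT
  have hq₂ne : 0 ≠ s * (ht e q₂ - tk) := by
    intro h0
    have hteq : ht e q₂ = tk := by
      rcases hs with rfl | rfl <;> [linarith; linarith]
    have : Leaf.pt q₂ = xk := by rw [hq₂.pt_eq, hteq, hxk]
    exact (hLU ⟨xk, this ▸ q₂.2, rfl⟩).1 hk
  have hq₂pos : 0 < s * (ht e q₂ - tk) :=
    hsignL q₂ hq₂ (by rw [habs _ (lt_of_le_of_ne hq₂T.1 hq₂ne)]; exact hq₂T.2.trans_lt (ht1.trans (by rw [← hε₂abs]; exact hc₁ε)))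
  have hq₂lt : s * (ht e q₂ - tk) < s * (t - tk) := by
    refine lt_of_le_of_ne hq₂T.2 fun h ↦ htL ?_
    have hteq : ht e q₂ = t := by rcases hs with rfl | rfl <;> [linarith; linarith]
    have := F.height_mem_leafHeights q₂.2 hq₂.1
    have h2 : (e (Leaf.pt q₂)).2 = t := hteq
    exact h2 ▸ this
  -- the last crossing `p` with `c₁ ≤ p < q₂` and height in `Wset`
  set S : Set (F.Leaf y₀) := {r ∈ leafIcc hbi c₁ q₂ | IsCrossing e u₀ r ∧ ht e r ∈ Wset} ∩ {r | leafLT hbi r q₂} with hSdef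
  have hSf : S.Finite := (finite_crossings_leafIcc hbi he hWc hWb c₁ q₂).inter_of_left _
  have hc₁W : ht e c₁ ∈ Wset := ⟨hc₁pos.le, le_rfl⟩
  have hc₁S : c₁ ∈ S := ⟨⟨left_mem_leafIcc (leafLT_asymm hc₁q₂), hc₁, hc₁W⟩, hc₁q₂⟩
  obtain ⟨n, hn⟩ := exists_subset_lineCharts_source (hbi := hbi) (isCompact_leafIcc (hbi := hbi) c₁ q₂)
  obtain ⟨p, hpS, hpmax⟩ := Set.exists_max_image S (lineCharts hbi y₀ n) hSf ⟨c₁, hc₁S⟩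
  have hpI : p ∈ leafIcc hbi c₁ q₂ := hpS.1.1
  have hp : IsCrossing e u₀ p := hpS.1.2.1
  have hpW : ht e p ∈ Wset := hpS.1.2.2
  have hpq₂ : leafLT hbi p q₂ := hpS.2
  have hlast : ∀ r, leafLT hbi p r → leafLT hbi r q₂ → ¬ (IsCrossing e u₀ r ∧ ht e r ∈ Wset) := by
    intro r hpr hrq₂ hr
    have hc₁r : leafLT hbi c₁ r := by
      rcases not_leafLT_iff.1 hpI.1 with h | h
      · exact leafLT_trans h hpr
      · exact h ▸ hpr
    have hrS : r ∈ S := ⟨⟨⟨leafLT_asymm hc₁r, leafLT_asymm hrq₂⟩, hr⟩, hrq₂⟩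
    have hle := hpmax r hrS
    have hlt := (leafLT_iff (hn hpI) (hn hrS.1.1)).1 hpr
    exact absurd hle (not_le.2 hlt)
  -- the height of `p` is beyond `t`
  have htp : s * (t - tk) < s * (ht e p - tk) := by
    by_contra hle
    push Not at hle
    have hpT : ht e p ∈ Tset := ⟨hpW.1, hle⟩
    rcases not_leafLT_iff.1 hpI.1 with h | h
    · exact hfirst p h hpq₂ ⟨hp, hpT⟩
    · rw [← h] at hle; linarith
  -- the sack
  have hsucc : ∀ r, leafLT hbi p r → leafLT hbi r q₂ → IsCrossing e u₀ r → ht e r ∉ uIcc (ht e q₂) (ht e p) := by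
    intro r hpr hrq₂ hr hrI
    refine hlast r hpr hrq₂ ⟨hr, ?_⟩
    -- `uIcc (ht q₂) (ht p) ⊆ Wset`
    rcases hs with rfl | rfl
    · rw [uIcc_of_le (by linarith : ht e q₂ ≤ ht e p)] at hrI
      exact ⟨by nlinarith [hrI.1], by nlinarith [hrI.2, hpW.2]⟩
    · rw [uIcc_of_ge (by linarith : ht e p ≤ ht e q₂)] at hrI
      exact ⟨by nlinarith [hrI.2], by nlinarith [hrI.1, hpW.2]⟩
  let Dk : SackData hbi y₀ e u₀ := ⟨p, q₂, hpq₂, hp, hq₂, hsucc⟩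
  have htlo : Dk.tlo = min (ht e p) (ht e q₂) := rfl
  have hthi : Dk.thi = max (ht e p) (ht e q₂) := rfl
  have hwin : ∀ h ∈ Icc Dk.tlo Dk.thi, 0 < s * (h - tk) ∧ |h - tk| < ε₁ := by
    intro h hh
    rw [htlo, hthi] at hh
    have hε₂ε₁ : ε₂ < ε₁ := by rw [← hε₂abs]; exact hc₁ε
    have hq₂W : s * (ht e q₂ - tk) ≤ ε₂ := (hq₂lt.trans htp).le.trans hpW.2
    have hbounds : 0 < s * (h - tk) ∧ s * (h - tk) ≤ ε₂ := by
      rcases hs with rfl | rfl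
      · rw [min_eq_right (by linarith : ht e q₂ ≤ ht e p), max_eq_left (by linarith : ht e q₂ ≤ ht e p)] at hh
        constructor <;> nlinarith [hh.1, hh.2, hpW.2]
      · rw [min_eq_left (by linarith : ht e p ≤ ht e q₂), max_eq_right (by linarith : ht e p ≤ ht e q₂)] at hh
        constructor <;> nlinarith [hh.1, hh.2, hpW.2]
    refine ⟨hbounds.1, ?_⟩
    rw [habs _ hbounds.1]
    exact hbounds.2.trans_lt hε₂ε₁
  refine ⟨Dk, ?_, hwin, ?_⟩
  · rw [mem_Ioo, htlo, hthi]
    rcases hs with rfl | rfl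
    · rw [min_eq_right (by linarith), max_eq_left (by linarith)]; constructor <;> linarith
    · rw [min_eq_left (by linarith), max_eq_right (by linarith)]; constructor <;> linarith
  · -- `ι xk` is off the boundary and in the closure of the right side
    have hιc := hι.continuous
    have hTXc : IsClosed (ι '' Dk.traceX) := ((Dk.isCompact_traceX he).image hιc).isClosed
    have hnot : ι xk ∉ ι '' Dk.traceX := by
      rintro ⟨w, hw, hwk⟩
      have hw' : w = xk := hι.injective hwk
      subst hw'
      rcases hw with ⟨sg, -, hsg⟩ | ⟨t', ht'I, ht'⟩
      · have hwL : w ∈ F.leaf y₀ := by rw [← hsg]; exact (Dk.g.symm sg).2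
        exact (hLU ⟨w, hwL, rfl⟩).1 hk
      · have h1 : e w = (u₀, t') := by
          rw [← ht', SackData.vert, e.right_inv (by rw [F.target_eq e he]; exact mem_univ _)]
        have ht'eq : t' = tk := by rw [show tk = (e w).2 from rfl, h1]
        rw [Dk.uIcc_eq] at ht'I
        have := (hwin t' ht'I).1
        rw [ht'eq, sub_self, mul_zero] at this
        exact lt_irrefl _ this
    obtain ⟨q₃, hq₂q₃⟩ : ∃ q₃, leafLT hbi q₂ q₃ := (frequently_leafLT_right (hbi := hbi) q₂).exists
    have hcl : ι xk ∈ closure (Dk.rightSide he ι) := by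
      refine closure_mono ?_ (mem_omegaSet_iff.1 hω q₃)
      rintro _ ⟨q, hq, rfl⟩
      have hq₂q : leafLT hbi q₂ q := by
        rcases not_leafLT_iff.1 hq with h | h
        · exact leafLT_trans hq₂q₃ h
        · exact h ▸ hq₂q₃
      exact Dk.mem_rightSide_of_lt he hι hq₂q
    exact ((closure_connectedComponentIn_compl_subset hTXc _) hcl).resolve_right hnot

include hι hk hLU he hxke hs hsignL hc₁ hc₁ε ht0 ht1 htL in
omit [Nonempty X] in
/-- **The sack of a good height** (α-version). If `ι xk ∈ α(L)`, for a height `t` on the inner side,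
closer to the height of `xk` than the reference crossing `c₁` and not a leaf height of `L`, two
crossings of `L` successive in the height window give a sack with `t` strictly between their
heights, the whole height interval on the inner side within `ε₁`, and `ι xk` in the left side.
[cite: CamachoLinsNeto1985, Ch. VII §2] -/
theorem exists_sack_alpha (hα : ι xk ∈ alphaSet hbi ι y₀) :
    ∃ Dk : SackData hbi y₀ e (e xk).1, t ∈ Ioo Dk.tlo Dk.thi ∧
      (∀ h ∈ Icc Dk.tlo Dk.thi, 0 < s * (h - (e xk).2) ∧ |h - (e xk).2| < ε₁) ∧ ι xk ∈ Dk.leftSide he ι := by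
  set u₀ := (e xk).1 with hu₀
  set tk := (e xk).2 with htk
  have habs : ∀ h : ℝ, 0 < s * (h - tk) → |h - tk| = s * (h - tk) := fun h hh ↦ by
    rcases hs with rfl | rfl
    · rw [one_mul] at hh ⊢; exact abs_of_pos hh
    · rw [neg_one_mul] at hh ⊢; exact abs_of_neg (by linarith)
  have hxk : e.symm (u₀, tk) = xk := by rw [show (u₀, tk) = e xk from rfl, e.left_inv hxke]
  have hαv : ι (e.symm (u₀, tk)) ∈ alphaSet hbi ι y₀ := by rw [hxk]; exact hα
  have hc₁pos := hsignL c₁ hc₁ hc₁ε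
  set ε₂ := s * (ht e c₁ - tk) with hε₂
  have hε₂abs : |ht e c₁ - tk| = ε₂ := habs _ hc₁pos
  have hne₁ : ht e c₁ ≠ tk := fun h ↦ by
    have := hc₁pos; rw [hε₂, h, sub_self, mul_zero] at this; exact lt_irrefl _ this
  -- the height windows
  set Tset : Set ℝ := {h | 0 ≤ s * (h - tk) ∧ s * (h - tk) ≤ s * (t - tk)} with hTset
  set Wset : Set ℝ := {h | 0 ≤ s * (h - tk) ∧ s * (h - tk) ≤ ε₂} with hWset
  have hcf : Continuous fun h : ℝ ↦ s * (h - tk) := by fun_prop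
  have hTc : IsClosed Tset := (isClosed_le continuous_const hcf).inter (isClosed_le hcf continuous_const)
  have hWc : IsClosed Wset := (isClosed_le continuous_const hcf).inter (isClosed_le hcf continuous_const)
  have hbdd : ∀ {S : Set ℝ}, S ⊆ {h | 0 ≤ s * (h - tk) ∧ s * (h - tk) ≤ ε₂} → Bornology.IsBounded S := fun {S} hS ↦
    (Metric.isBounded_Icc (tk - ε₂) (tk + ε₂)).subset fun h hh ↦ by
      obtain ⟨h1, h2⟩ := hS hh
      rcases hs with rfl | rfl
      · constructor <;> linarith
      · constructor <;> linarith
  have hTW : Tset ⊆ Wset := fun h hh ↦ ⟨hh.1, hh.2.trans ht1.le⟩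
  have hTb : Bornology.IsBounded Tset := hbdd hTW
  have hWb : Bornology.IsBounded Wset := hbdd Subset.rfl
  -- a crossing before `c₁` with height in `Tset`
  obtain ⟨c, hcc₁, hc, hcnear⟩ := exists_crossing_near_alpha (hbi := hbi) he hι hαv hc₁ hne₁ ht0 (by rw [hε₂abs]; exact ht1.le)
  have hcpos : 0 < s * (ht e c - tk) := hsignL c hc (hcnear.trans (ht1.trans (by rw [← hε₂abs]; exact hc₁ε)))
  have hcT : ht e c ∈ Tset := ⟨hcpos.le, by
    have := habs _ hcpos; rw [this] at hcnear; exact hcnear.le⟩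
  -- the last crossing `q₁` before `c₁` (after `c`) with height in `Tset`
  obtain ⟨n, hn⟩ := exists_subset_lineCharts_source (hbi := hbi) (isCompact_leafIcc (hbi := hbi) c c₁)
  set ST : Set (F.Leaf y₀) := {r ∈ leafIcc hbi c c₁ | IsCrossing e u₀ r ∧ ht e r ∈ Tset} ∩ {r | leafLT hbi r c₁} with hSTdef
  have hSTf : ST.Finite := (finite_crossings_leafIcc hbi he hTc hTb c c₁).inter_of_left _
  have hcST : c ∈ ST := ⟨⟨left_mem_leafIcc (leafLT_asymm hcc₁), hc, hcT⟩, hcc₁⟩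
  obtain ⟨q₁, hq₁S, hq₁max⟩ := Set.exists_max_image ST (lineCharts hbi y₀ n) hSTf ⟨c, hcST⟩
  have hq₁I : q₁ ∈ leafIcc hbi c c₁ := hq₁S.1.1
  have hq₁ : IsCrossing e u₀ q₁ := hq₁S.1.2.1
  have hq₁T : ht e q₁ ∈ Tset := hq₁S.1.2.2
  have hq₁c₁ : leafLT hbi q₁ c₁ := hq₁S.2
  have hlastT : ∀ r, leafLT hbi q₁ r → leafLT hbi r c₁ → ¬ (IsCrossing e u₀ r ∧ ht e r ∈ Tset) := by
    intro r hq₁r hrc₁ hr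
    have hcr : leafLT hbi c r := by
      rcases not_leafLT_iff.1 hq₁I.1 with h | h
      · exact leafLT_trans h hq₁r
      · exact h ▸ hq₁r
    have hrS : r ∈ ST := ⟨⟨⟨leafLT_asymm hcr, leafLT_asymm hrc₁⟩, hr⟩, hrc₁⟩
    have hle := hq₁max r hrS
    have hlt := (leafLT_iff (hn hq₁I) (hn hrS.1.1)).1 hq₁r
    exact absurd hle (not_le.2 hlt)
  have hq₁ne : 0 ≠ s * (ht e q₁ - tk) := by
    intro h0
    have hteq : ht e q₁ = tk := by
      rcases hs with rfl | rfl <;> [linarith; linarith]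
    have : Leaf.pt q₁ = xk := by rw [hq₁.pt_eq, hteq, hxk]
    exact (hLU ⟨xk, this ▸ q₁.2, rfl⟩).1 hk
  have hq₁pos : 0 < s * (ht e q₁ - tk) :=
    hsignL q₁ hq₁ (by rw [habs _ (lt_of_le_of_ne hq₁T.1 hq₁ne)]; exact hq₁T.2.trans_lt (ht1.trans (by rw [← hε₂abs]; exact hc₁ε)))
  have hq₁lt : s * (ht e q₁ - tk) < s * (t - tk) := by
    refine lt_of_le_of_ne hq₁T.2 fun h ↦ htL ?_
    have hteq : ht e q₁ = t := by rcases hs with rfl | rfl <;> [linarith; linarith]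
    have := F.height_mem_leafHeights q₁.2 hq₁.1
    have h2 : (e (Leaf.pt q₁)).2 = t := hteq
    exact h2 ▸ this
  -- the first crossing `p` after `q₁`, up to `c₁`, with height in `Wset`
  have hc₁W : ht e c₁ ∈ Wset := ⟨hc₁pos.le, le_rfl⟩
  obtain ⟨p, hq₁p, hpc₁, hp, hpW, hfirstW⟩ := exists_first_crossing (hbi := hbi) he hWc hWb hq₁c₁ hc₁ hc₁W
  -- the height of `p` is beyond `t`
  have htp : s * (t - tk) < s * (ht e p - tk) := by
    by_contra hle
    push Not at hle
    have hpT : ht e p ∈ Tset := ⟨hpW.1, hle⟩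
    rcases not_leafLT_iff.1 hpc₁ with h | h
    · exact hlastT p hq₁p h ⟨hp, hpT⟩
    · rw [h] at hle; linarith
  -- the sack
  have hsucc : ∀ r, leafLT hbi q₁ r → leafLT hbi r p → IsCrossing e u₀ r → ht e r ∉ uIcc (ht e p) (ht e q₁) := by
    intro r hq₁r hrp hr hrI
    refine hfirstW r hq₁r hrp ⟨hr, ?_⟩
    rcases hs with rfl | rfl
    · rw [uIcc_of_ge (by linarith : ht e q₁ ≤ ht e p)] at hrI
      exact ⟨by nlinarith [hrI.1], by nlinarith [hrI.2, hpW.2]⟩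
    · rw [uIcc_of_le (by linarith : ht e p ≤ ht e q₁)] at hrI
      exact ⟨by nlinarith [hrI.2], by nlinarith [hrI.1, hpW.2]⟩
  let Dk : SackData hbi y₀ e u₀ := ⟨q₁, p, hq₁p, hq₁, hp, hsucc⟩
  have htlo : Dk.tlo = min (ht e q₁) (ht e p) := rfl
  have hthi : Dk.thi = max (ht e q₁) (ht e p) := rfl
  have hwin : ∀ h ∈ Icc Dk.tlo Dk.thi, 0 < s * (h - tk) ∧ |h - tk| < ε₁ := by
    intro h hh
    rw [htlo, hthi] at hh
    have hε₂ε₁ : ε₂ < ε₁ := by rw [← hε₂abs]; exact hc₁ε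
    have hq₁W : s * (ht e q₁ - tk) ≤ ε₂ := (hq₁lt.trans htp).le.trans hpW.2
    have hbounds : 0 < s * (h - tk) ∧ s * (h - tk) ≤ ε₂ := by
      rcases hs with rfl | rfl
      · rw [min_eq_left (by linarith : ht e q₁ ≤ ht e p), max_eq_right (by linarith : ht e q₁ ≤ ht e p)] at hh
        constructor <;> nlinarith [hh.1, hh.2, hpW.2]
      · rw [min_eq_right (by linarith : ht e p ≤ ht e q₁), max_eq_left (by linarith : ht e p ≤ ht e q₁)] at hh
        constructor <;> nlinarith [hh.1, hh.2, hpW.2]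
    refine ⟨hbounds.1, ?_⟩
    rw [habs _ hbounds.1]
    exact hbounds.2.trans_lt hε₂ε₁
  refine ⟨Dk, ?_, hwin, ?_⟩
  · rw [mem_Ioo, htlo, hthi]
    rcases hs with rfl | rfl
    · rw [min_eq_left (by linarith), max_eq_right (by linarith)]; constructor <;> linarith
    · rw [min_eq_right (by linarith), max_eq_left (by linarith)]; constructor <;> linarith
  · -- `ι xk` is off the boundary and in the closure of the left side
    have hιc := hι.continuous
    have hTXc : IsClosed (ι '' Dk.traceX) := ((Dk.isCompact_traceX he).image hιc).isClosed
    have hnot : ι xk ∉ ι '' Dk.traceX := by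
      rintro ⟨w, hw, hwk⟩
      have hw' : w = xk := hι.injective hwk
      subst hw'
      rcases hw with ⟨sg, -, hsg⟩ | ⟨t', ht'I, ht'⟩
      · have hwL : w ∈ F.leaf y₀ := by rw [← hsg]; exact (Dk.g.symm sg).2
        exact (hLU ⟨w, hwL, rfl⟩).1 hk
      · have h1 : e w = (u₀, t') := by
          rw [← ht', SackData.vert, e.right_inv (by rw [F.target_eq e he]; exact mem_univ _)]
        have ht'eq : t' = tk := by rw [show tk = (e w).2 from rfl, h1]
        rw [Dk.uIcc_eq] at ht'I
        have := (hwin t' ht'I).1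
        rw [ht'eq, sub_self, mul_zero] at this
        exact lt_irrefl _ this
    obtain ⟨q₀, hq₀q₁⟩ : ∃ q₀, leafLT hbi q₀ q₁ := (frequently_leafLT_left (hbi := hbi) q₁).exists
    have hcl : ι xk ∈ closure (Dk.leftSide he ι) := by
      refine closure_mono ?_ (mem_alphaSet_iff.1 hα q₀)
      rintro _ ⟨q, hq, rfl⟩
      have hqq₁ : leafLT hbi q q₁ := by
        rcases not_leafLT_iff.1 hq with h | h
        · exact leafLT_trans h hq₀q₁
        · exact h ▸ hq₀q₁
      exact Dk.mem_leftSide_of_gt he hι hqq₁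
    exact ((closure_connectedComponentIn_compl_subset hTXc _) hcl).resolve_right hnot

end Sack

/-! ## The zone argument -/

section Zone

variable {s ε₁ : ℝ} (hs : s = 1 ∨ s = -1) (hε₁ : 0 < ε₁)
  (hin : ∀ u t, |u - (e xk).1| < ε₁ → |t - (e xk).2| < ε₁ → 0 < s * (t - (e xk).2) → ι (e.symm (u, t)) ∈ IsJordanLoop.inside γ)
  (Dk : SackData hbi y₀ e (e xk).1) (hwin : ∀ h ∈ Icc Dk.tlo Dk.thi, 0 < s * (h - (e xk).2) ∧ |h - (e xk).2| < ε₁)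
  {t : ℝ} (htI : t ∈ Ioo Dk.tlo Dk.thi) (htL : t ∉ F.leafHeights e y₀)
  (htA : t ∉ ⋃ v ∈ D.P, ⋃ sl ∈ D.levelLeaves v, F.leafHeights e sl)
  (hLreg : ∃ z ∈ omegaSet hbi ι y₀ ∪ alphaSet hbi ι y₀, z ∈ range ι)

include hLU hin hwin in
omit [Nonempty X] in
/-- **The trace of `γ` misses the sack boundary.** [folklore] -/
theorem range_disjoint_traceX : range γ ⊆ (ι '' Dk.traceX)ᶜ := by
  rintro z hz ⟨w, hw, rfl⟩
  rcases hw with ⟨sg, -, hsg⟩ | ⟨t', ht'I, ht'⟩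
  · have hwL : w ∈ F.leaf y₀ := by rw [← hsg]; exact (Dk.g.symm sg).2
    exact (hLU ⟨w, hwL, rfl⟩).1 hz
  · rw [Dk.uIcc_eq] at ht'I
    obtain ⟨hpos, hnear⟩ := hwin t' ht'I
    have hins := hin (e xk).1 t' (by rw [sub_self, abs_zero]; linarith [hnear, abs_nonneg (t' - (e xk).2)]) hnear hpos
    rw [← ht'] at hz
    exact hins.1 hz

include hJ hLU hin hwin in
omit [Nonempty X] in
/-- **The trace of `γ` lies in the side of the sack containing `ι xk`.** [folklore] -/
theorem range_subset_rightSide (hxkR : ι xk ∈ Dk.rightSide he ι) (hk : ι xk ∈ range γ) :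
    range γ ⊆ Dk.rightSide he ι := by
  have h := (isPreconnected_range hJ.continuous).subset_connectedComponentIn hk
    (range_disjoint_traceX hbi hLU hin Dk hwin)
  unfold SackData.rightSide at hxkR ⊢
  rwa [connectedComponentIn_eq hxkR]

include hJ hLU hin hwin in
omit [Nonempty X] in
/-- The same for the left side. [folklore] -/
theorem range_subset_leftSide (hxkL : ι xk ∈ Dk.leftSide he ι) (hk : ι xk ∈ range γ) :
    range γ ⊆ Dk.leftSide he ι := by
  have h := (isPreconnected_range hJ.continuous).subset_connectedComponentIn hk
    (range_disjoint_traceX hbi hLU hin Dk hwin)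
  unfold SackData.leftSide at hxkL ⊢
  rwa [connectedComponentIn_eq hxkL]

include hι hJ hsat he hin hwin htI htL in
omit [Nonempty X] in
/-- **The trapped leaf**: the leaf through the vertical point at the good height `t` is open,
disjoint from `L`, inside `γ`, and crosses the segment strictly inside at its base point.
[folklore] -/
theorem trappedLeaf :
    e.symm ((e xk).1, t) ∉ F.leaf y₀ ∧ Disjoint (F.leaf (e.symm ((e xk).1, t))) (F.leaf y₀) ∧
      ¬ IsCompact (F.leaf (e.symm ((e xk).1, t))) ∧ ι '' F.leaf (e.symm ((e xk).1, t)) ⊆ IsJordanLoop.inside γ ∧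
      e.symm ((e xk).1, t) ∈ e.source ∧ e (e.symm ((e xk).1, t)) = ((e xk).1, t) := by
  set xt := e.symm ((e xk).1, t) with hxt
  have htarget : ((e xk).1, t) ∈ e.target := by rw [F.target_eq e he]; exact mem_univ _
  have hsrc : xt ∈ e.source := e.map_target htarget
  have hext : e xt = ((e xk).1, t) := e.right_inv htarget
  have hxtL : xt ∉ F.leaf y₀ := fun h ↦ htL (by
    have := F.height_mem_leafHeights h hsrc; rwa [hext] at this)
  have hdisj : Disjoint (F.leaf xt) (F.leaf y₀) := disjoint_leaf_of_not_mem hxtL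
  have hnc : ¬ IsCompact (F.leaf xt) := fun hK ↦ Dk.false_of_compact_leaf he hι hK hdisj htI (F.mem_leaf_self xt)
  -- inside `γ`
  obtain ⟨hpos, hnear⟩ := hwin t ⟨htI.1.le, htI.2.le⟩
  have hxtin : ι xt ∈ IsJordanLoop.inside γ := hin _ _ (by rw [sub_self, abs_zero]; linarith [abs_nonneg (t - (e xk).2)]) hnear hpos
  have hsub : ι '' F.leaf xt ⊆ (range γ)ᶜ := by
    rintro _ ⟨w, hw, rfl⟩ hwr
    have : ι xt ∈ range γ := hsat w hwr xt (mem_leaf_comm.1 hw)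
    exact hxtin.1 this
  have hU : ι '' F.leaf xt ⊆ IsJordanLoop.inside γ := by
    have h := (isPreconnected_image_leaf hι.continuous xt).subset_connectedComponentIn ⟨xt, F.mem_leaf_self xt, rfl⟩ hsub
    rwa [← hJ.inside_eq_connectedComponentIn hxtin] at h
  exact ⟨hxtL, hdisj, hnc, hU, hsrc, hext⟩

include ho hC hCΩ hJ hγC hsat hcpt hpoly hLU hk he hin hwin htI htL htA hLreg in
/-- **The zone argument (ω-version).** With the sack of a good height and `ι xk`, hence the trace
of `γ`, in the right side, the α-limit set of the trapped leaf — in the closure of the left side —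
is impossible: not all punctures (`t` is off the level-leaf heights), no compact leaf (essential yet
image-null), no line leaf (hugging gives an essential polygon in the left side, on the trace).
[cite: CamachoLinsNeto1985, Ch. VII §2] -/
theorem false_of_sack_right (hxkR : ι xk ∈ Dk.rightSide he ι) : False := by
  have hιc := hι.continuous
  have hιi := hι.injective
  obtain ⟨hxtL, hdisj, hnc, hU, hsrc, hext⟩ := trappedLeaf hbi hι hJ hsat he hin Dk hwin htI htL
  set xt := e.symm ((e xk).1, t) with hxt
  haveI : NoncompactSpace (F.Leaf xt) := noncompactSpace_leaf_of_not_isCompact' hnc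
  -- the base point is a crossing strictly inside
  have hct : IsCrossing e (e xk).1 (Leaf.base F xt) := ⟨hsrc, by show (e xt).1 = (e xk).1; rw [hext]⟩
  have hctt : ht e (Leaf.base F xt) = t := by show (e xt).2 = t; rw [hext]
  have hctI : ht e (Leaf.base F xt) ∈ Ioo Dk.tlo Dk.thi := by rw [hctt]; exact htI
  -- ambient facts
  have hγR : range γ ⊆ Dk.rightSide he ι := range_subset_rightSide hbi hJ hLU he hin Dk hwin hxkR hk
  have hfill : closure (ι '' F.leaf xt) ⊆ IsJordanLoop.fill γ := by
    rw [IsJordanLoop.fill, union_comm, ← hJ.closure_inside_eq]; exact closure_mono hU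
  have hmemt : ∀ q : F.Leaf xt, ι (Leaf.pt q) ∈ C := fun q ↦
    hγC (hfill (subset_closure ⟨Leaf.pt q, q.2, rfl⟩))
  have hαcl : alphaSet hbi ι xt ⊆ closure (Dk.leftSide he ι) := Dk.alphaSet_subset_closure_leftSide he hι hdisj hct hctI
  have hαfill : alphaSet hbi ι xt ⊆ IsJordanLoop.fill γ := fun z hz ↦
    hfill (limitSets_subset_closure hι (Or.inr hz))
  have hTXc : IsClosed (ι '' Dk.traceX) := ((Dk.isCompact_traceX he).image hιc).isClosed
  have hRo : IsOpen (Dk.rightSide he ι) := hTXc.isOpen_compl.connectedComponentIn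
  have hLo : IsOpen (Dk.leftSide he ι) := hTXc.isOpen_compl.connectedComponentIn
  have hRL : ∀ {z}, z ∈ Dk.rightSide he ι → z ∈ Dk.leftSide he ι → False := fun {z} hzR hzL ↦
    Dk.rightSide_ne_leftSide he hι (by
      unfold SackData.rightSide at hzR ⊢; unfold SackData.leftSide at hzL ⊢
      rw [connectedComponentIn_eq hzR, connectedComponentIn_eq hzL])
  have hL_nc : ¬ IsCompact (F.leaf y₀) := not_isCompact_leaf_of_noncompactSpace
  -- case (B): a compact leaf in the α-limit set
  by_cases hB : ∃ y', ι y' ∈ alphaSet hbi ι xt ∧ IsCompact (F.leaf y')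
  · obtain ⟨y', hy'α, hK'⟩ := hB
    have hess := not_imageNull_of_mem_alphaSet hbi hι ho D.foliated hy'α hK'
    refine hess (hcpt y' hK' ?_ ?_)
    · rintro _ ⟨w, hw, rfl⟩
      exact hαfill (mem_alphaSet_of_mem_leaf hι hy'α hw)
    · -- the compact leaf is in the left side: it is in its closure and misses the boundary
      have hy'L : y' ∉ F.leaf y₀ := fun h ↦ hL_nc (by rw [← leaf_eq_of_mem h]; exact hK')
      have hdisj' : Disjoint (F.leaf y') (F.leaf y₀) := disjoint_leaf_of_not_mem hy'L
      have hoff : Disjoint (F.leaf y') Dk.traceX := by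
        refine disjoint_left.2 fun w hw hwT ↦ ?_
        rcases hwT with ⟨sg, -, hsg⟩ | ⟨t', ht'I, ht'⟩
        · exact disjoint_left.1 hdisj' hw (by rw [← hsg]; exact (Dk.g.symm sg).2)
        · rw [Dk.uIcc_eq] at ht'I
          -- interior height: the end points are on `L`
          have ht'Ioo : t' ∈ Ioo Dk.tlo Dk.thi := by
            have hne : ∀ (p : F.Leaf y₀), IsCrossing e (e xk).1 p → t' ≠ ht e p := by
              intro p hp h
              have : w = Leaf.pt p := by rw [← ht', hp.pt_eq, h]; rfl
              exact disjoint_left.1 hdisj' hw (this ▸ p.2)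
            refine ⟨lt_of_le_of_ne ht'I.1 fun h ↦ ?_, lt_of_le_of_ne ht'I.2 fun h ↦ ?_⟩
            · rcases min_choice Dk.t₁ Dk.t₂ with h' | h'
              · exact hne _ Dk.cross₁ (h.symm.trans h')
              · exact hne _ Dk.cross₂ (h.symm.trans h')
            · rcases max_choice Dk.t₁ Dk.t₂ with h' | h'
              · exact hne _ Dk.cross₁ (h.trans h')
              · exact hne _ Dk.cross₂ (h.trans h')
          exact Dk.false_of_compact_leaf he hι hK' hdisj' ht'Ioo (by rw [← ht'] at hw; exact hw)
      have hsubT : ι '' F.leaf y' ⊆ (ι '' Dk.traceX)ᶜ := Dk.image_subset_compl hιi hoff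
      have hK'L : ι '' F.leaf y' ⊆ Dk.leftSide he ι := fun z hz ↦ by
        obtain ⟨w, hw, rfl⟩ := hz
        have hcl : ι w ∈ closure (Dk.leftSide he ι) := hαcl (mem_alphaSet_of_mem_leaf hι hy'α hw)
        exact ((closure_connectedComponentIn_compl_subset hTXc _) hcl).resolve_right (hsubT ⟨w, hw, rfl⟩)
      exact disjoint_left.2 fun z hzK hzγ ↦ hRL (hγR hzγ) (hK'L hzK)
  -- case (C): a line leaf in the α-limit set
  by_cases hCc : ∃ y', ι y' ∈ alphaSet hbi ι xt ∧ ¬ IsCompact (F.leaf y')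
  · obtain ⟨y', hy'α, hy'nc⟩ := hCc
    have hy'G : ι y' ∈ limGraph hbi ι xt := ⟨Or.inr hy'α, y', rfl, hy'nc⟩
    have h0 : ι y' ∈ Dk.leftSide he ι :=
      D.image_leaf_subset_leftSide hbi hι hC hCΩ hmemt Dk he hdisj hct hctI hLreg hy'G (hαcl hy'α) ⟨y', F.mem_leaf_self y', rfl⟩
    obtain ⟨Q, hQ, hQess⟩ := D.exists_polyCycle_of_mem_limGraph hbi hι ho hC hCΩ hmemt hy'G
      (Pinv := fun y ↦ ι y ∈ Dk.leftSide he ι) h0 (by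
        intro y₁ y₂ hy₁ hy₂ _ _ w hwP hω₁ hα₂ h1
        have hS₁ : ι '' F.leaf y₁ ⊆ Dk.leftSide he ι :=
          D.image_leaf_subset_leftSide hbi hι hC hCΩ hmemt Dk he hdisj hct hctI hLreg hy₁ (subset_closure h1)
        have hwι : w ∉ range ι := by rw [D.range_eq]; exact fun h ↦ h.2 hwP
        have hwcl₁ : w ∈ closure (ι '' F.leaf y₁) := by
          have : w ∈ omegaSet hbi ι y₁ := by rw [hω₁]; exact mem_singleton _
          exact limitSets_subset_closure hι (Or.inl this)
        have hwL : w ∈ Dk.leftSide he ι := Dk.mem_leftSide_of_mem_closure he hι hS₁ hwcl₁ hwι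
        have hwcl₂ : w ∈ closure (ι '' F.leaf y₂) := by
          have : w ∈ alphaSet hbi ι y₂ := by rw [hα₂]; exact mem_singleton _
          exact limitSets_subset_closure hι (Or.inr this)
        rcases D.image_leaf_subset_side_of_limGraph hbi hι hC hCΩ hmemt Dk he hdisj hct hctI hLreg hy₂ with hS₂ | hS₂
        · exact absurd (Dk.mem_rightSide_of_mem_closure he hι hS₂ hwcl₂ hwι) fun hwR ↦ hRL hwR hwL
        · exact hS₂ ⟨y₂, F.mem_leaf_self y₂, rfl⟩)
    -- the polygon is essential, so its separatrices are on the trace, in the right side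
    haveI := Q.neZero
    have hQfill : ∀ i (q : F.Leaf (Q.sx i)), ι (Leaf.pt q) ∈ IsJordanLoop.fill γ := fun i q ↦ by
      have h1 := limGraph_subset (hQ i).1
      have h2 := mem_limitSets_of_mem_leaf hι h1 q.2
      exact hfill (limitSets_subset_closure hι h2)
    have hon := hpoly Q hQfill hQess (0 : Fin Q.m) (Leaf.base F (Q.sx 0))
    exact hRL (hγR hon) (hQ 0).2
  -- case (A): the α-limit set consists of punctures
  push Not at hB hCc
  have hαP : alphaSet hbi ι xt ⊆ D.P := fun z hz ↦ by
    have hzΩ : z ∈ D.Ω := hCΩ (alphaSet_subset_of_forall_mem hC.isClosed hmemt hz)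
    by_contra hzP
    have hzr : z ∈ range ι := by rw [D.range_eq]; exact ⟨hzΩ, hzP⟩
    obtain ⟨y', rfl⟩ := hzr
    exact hB y' hz (hCc y' hz)
  obtain ⟨v, hv, -, sl, hsl, hxt_sl⟩ := D.toPunctureData.exists_alphaSet_eq_singleton hι hC hmemt hαP
  refine htA (mem_iUnion₂.2 ⟨v, hv, mem_iUnion₂.2 ⟨sl, hsl, ?_⟩⟩)
  have := F.height_mem_leafHeights hxt_sl hsrc
  rwa [hext] at this

include ho hC hCΩ hJ hγC hsat hcpt hpoly hLU hk he hin hwin htI htL htA hLreg in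
/-- **The zone argument (α-version).** With the sack of a good height and `ι xk`, hence the trace
of `γ`, in the left side, the ω-limit set of the trapped leaf — in the closure of the right side —
is impossible: not all punctures (`t` is off the level-leaf heights), no compact leaf (essential yet
image-null), no line leaf (hugging gives an essential polygon in the right side, on the trace).
[cite: CamachoLinsNeto1985, Ch. VII §2] -/
theorem false_of_sack_left (hxkL : ι xk ∈ Dk.leftSide he ι) : False := by
  have hιc := hι.continuous
  have hιi := hι.injective
  obtain ⟨hxtL, hdisj, hnc, hU, hsrc, hext⟩ := trappedLeaf hbi hι hJ hsat he hin Dk hwin htI htL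
  set xt := e.symm ((e xk).1, t) with hxt
  haveI : NoncompactSpace (F.Leaf xt) := noncompactSpace_leaf_of_not_isCompact' hnc
  -- the base point is a crossing strictly inside
  have hct : IsCrossing e (e xk).1 (Leaf.base F xt) := ⟨hsrc, by show (e xt).1 = (e xk).1; rw [hext]⟩
  have hctt : ht e (Leaf.base F xt) = t := by show (e xt).2 = t; rw [hext]
  have hctI : ht e (Leaf.base F xt) ∈ Ioo Dk.tlo Dk.thi := by rw [hctt]; exact htI
  -- ambient facts
  have hγL : range γ ⊆ Dk.leftSide he ι := range_subset_leftSide hbi hJ hLU he hin Dk hwin hxkL hk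
  have hfill : closure (ι '' F.leaf xt) ⊆ IsJordanLoop.fill γ := by
    rw [IsJordanLoop.fill, union_comm, ← hJ.closure_inside_eq]; exact closure_mono hU
  have hmemt : ∀ q : F.Leaf xt, ι (Leaf.pt q) ∈ C := fun q ↦
    hγC (hfill (subset_closure ⟨Leaf.pt q, q.2, rfl⟩))
  have hωcl : omegaSet hbi ι xt ⊆ closure (Dk.rightSide he ι) := Dk.omegaSet_subset_closure_rightSide he hι hdisj hct hctI
  have hωfill : omegaSet hbi ι xt ⊆ IsJordanLoop.fill γ := fun z hz ↦
    hfill (limitSets_subset_closure hι (Or.inl hz))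
  have hTXc : IsClosed (ι '' Dk.traceX) := ((Dk.isCompact_traceX he).image hιc).isClosed
  have hRo : IsOpen (Dk.rightSide he ι) := hTXc.isOpen_compl.connectedComponentIn
  have hLo : IsOpen (Dk.leftSide he ι) := hTXc.isOpen_compl.connectedComponentIn
  have hRL : ∀ {z}, z ∈ Dk.rightSide he ι → z ∈ Dk.leftSide he ι → False := fun {z} hzR hzL ↦
    Dk.rightSide_ne_leftSide he hι (by
      unfold SackData.rightSide at hzR ⊢; unfold SackData.leftSide at hzL ⊢
      rw [connectedComponentIn_eq hzR, connectedComponentIn_eq hzL])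
  have hL_nc : ¬ IsCompact (F.leaf y₀) := not_isCompact_leaf_of_noncompactSpace
  -- case (B): a compact leaf in the ω-limit set
  by_cases hB : ∃ y', ι y' ∈ omegaSet hbi ι xt ∧ IsCompact (F.leaf y')
  · obtain ⟨y', hy'ω, hK'⟩ := hB
    have hess := not_imageNull_of_mem_omegaSet hbi hι ho D.foliated hy'ω hK'
    refine hess (hcpt y' hK' ?_ ?_)
    · rintro _ ⟨w, hw, rfl⟩
      exact hωfill (mem_omegaSet_of_mem_leaf hι hy'ω hw)
    · -- the compact leaf is in the right side: it is in its closure and misses the boundary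
      have hy'L : y' ∉ F.leaf y₀ := fun h ↦ hL_nc (by rw [← leaf_eq_of_mem h]; exact hK')
      have hdisj' : Disjoint (F.leaf y') (F.leaf y₀) := disjoint_leaf_of_not_mem hy'L
      have hoff : Disjoint (F.leaf y') Dk.traceX := by
        refine disjoint_left.2 fun w hw hwT ↦ ?_
        rcases hwT with ⟨sg, -, hsg⟩ | ⟨t', ht'I, ht'⟩
        · exact disjoint_left.1 hdisj' hw (by rw [← hsg]; exact (Dk.g.symm sg).2)
        · rw [Dk.uIcc_eq] at ht'I
          -- interior height: the end points are on `L`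
          have ht'Ioo : t' ∈ Ioo Dk.tlo Dk.thi := by
            have hne : ∀ (p : F.Leaf y₀), IsCrossing e (e xk).1 p → t' ≠ ht e p := by
              intro p hp h
              have : w = Leaf.pt p := by rw [← ht', hp.pt_eq, h]; rfl
              exact disjoint_left.1 hdisj' hw (this ▸ p.2)
            refine ⟨lt_of_le_of_ne ht'I.1 fun h ↦ ?_, lt_of_le_of_ne ht'I.2 fun h ↦ ?_⟩
            · rcases min_choice Dk.t₁ Dk.t₂ with h' | h'
              · exact hne _ Dk.cross₁ (h.symm.trans h')
              · exact hne _ Dk.cross₂ (h.symm.trans h')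
            · rcases max_choice Dk.t₁ Dk.t₂ with h' | h'
              · exact hne _ Dk.cross₁ (h.trans h')
              · exact hne _ Dk.cross₂ (h.trans h')
          exact Dk.false_of_compact_leaf he hι hK' hdisj' ht'Ioo (by rw [← ht'] at hw; exact hw)
      have hsubT : ι '' F.leaf y' ⊆ (ι '' Dk.traceX)ᶜ := Dk.image_subset_compl hιi hoff
      have hK'R : ι '' F.leaf y' ⊆ Dk.rightSide he ι := fun z hz ↦ by
        obtain ⟨w, hw, rfl⟩ := hz
        have hcl : ι w ∈ closure (Dk.rightSide he ι) := hωcl (mem_omegaSet_of_mem_leaf hι hy'ω hw)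
        exact ((closure_connectedComponentIn_compl_subset hTXc _) hcl).resolve_right (hsubT ⟨w, hw, rfl⟩)
      exact disjoint_left.2 fun z hzK hzγ ↦ hRL (hK'R hzK) (hγL hzγ)
  -- case (C): a line leaf in the ω-limit set
  by_cases hCc : ∃ y', ι y' ∈ omegaSet hbi ι xt ∧ ¬ IsCompact (F.leaf y')
  · obtain ⟨y', hy'ω, hy'nc⟩ := hCc
    have hy'G : ι y' ∈ limGraph hbi ι xt := ⟨Or.inl hy'ω, y', rfl, hy'nc⟩
    have h0 : ι y' ∈ Dk.rightSide he ι :=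
      D.image_leaf_subset_rightSide hbi hι hC hCΩ hmemt Dk he hdisj hct hctI hLreg hy'G (hωcl hy'ω) ⟨y', F.mem_leaf_self y', rfl⟩
    obtain ⟨Q, hQ, hQess⟩ := D.exists_polyCycle_of_mem_limGraph hbi hι ho hC hCΩ hmemt hy'G
      (Pinv := fun y ↦ ι y ∈ Dk.rightSide he ι) h0 (by
        intro y₁ y₂ hy₁ hy₂ _ _ w hwP hω₁ hα₂ h1
        have hS₁ : ι '' F.leaf y₁ ⊆ Dk.rightSide he ι :=
          D.image_leaf_subset_rightSide hbi hι hC hCΩ hmemt Dk he hdisj hct hctI hLreg hy₁ (subset_closure h1)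
        have hwι : w ∉ range ι := by rw [D.range_eq]; exact fun h ↦ h.2 hwP
        have hwcl₁ : w ∈ closure (ι '' F.leaf y₁) := by
          have : w ∈ omegaSet hbi ι y₁ := by rw [hω₁]; exact mem_singleton _
          exact limitSets_subset_closure hι (Or.inl this)
        have hwR : w ∈ Dk.rightSide he ι := Dk.mem_rightSide_of_mem_closure he hι hS₁ hwcl₁ hwι
        have hwcl₂ : w ∈ closure (ι '' F.leaf y₂) := by
          have : w ∈ alphaSet hbi ι y₂ := by rw [hα₂]; exact mem_singleton _
          exact limitSets_subset_closure hι (Or.inr this)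
        rcases D.image_leaf_subset_side_of_limGraph hbi hι hC hCΩ hmemt Dk he hdisj hct hctI hLreg hy₂ with hS₂ | hS₂
        · exact hS₂ ⟨y₂, F.mem_leaf_self y₂, rfl⟩
        · exact absurd (Dk.mem_leftSide_of_mem_closure he hι hS₂ hwcl₂ hwι) fun hwL ↦ hRL hwR hwL)
    -- the polygon is essential, so its separatrices are on the trace, in the left side
    haveI := Q.neZero
    have hQfill : ∀ i (q : F.Leaf (Q.sx i)), ι (Leaf.pt q) ∈ IsJordanLoop.fill γ := fun i q ↦ by
      have h1 := limGraph_subset (hQ i).1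
      have h2 := mem_limitSets_of_mem_leaf hι h1 q.2
      exact hfill (limitSets_subset_closure hι h2)
    have hon := hpoly Q hQfill hQess (0 : Fin Q.m) (Leaf.base F (Q.sx 0))
    exact hRL (hQ 0).2 (hγL hon)
  -- case (A): the ω-limit set consists of punctures
  push Not at hB hCc
  have hωP : omegaSet hbi ι xt ⊆ D.P := fun z hz ↦ by
    have hzΩ : z ∈ D.Ω := hCΩ (omegaSet_subset_of_forall_mem hC.isClosed hmemt hz)
    by_contra hzP
    have hzr : z ∈ range ι := by rw [D.range_eq]; exact ⟨hzΩ, hzP⟩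
    obtain ⟨y', rfl⟩ := hzr
    exact hB y' hz (hCc y' hz)
  obtain ⟨v, hv, -, sl, hsl, hxt_sl⟩ := D.toPunctureData.exists_omegaSet_eq_singleton hι hC hmemt hωP
  refine htA (mem_iUnion₂.2 ⟨v, hv, mem_iUnion₂.2 ⟨sl, hsl, ?_⟩⟩)
  have := F.height_mem_leafHeights hxt_sl hsrc
  rwa [hext] at this

end Zone

/-! ## No inner leaf accumulates on the trace -/

include ho hC hCΩ hJ hγC hsat hcpt hpoly hLU hk he hxke hloc in
/-- **No open leaf inside a terminal zone ω-accumulates on a point of the domain on its trace.**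
[cite: CamachoLinsNeto1985, Ch. VII §2] -/
theorem not_mem_omegaSet_of_zone : ι xk ∉ omegaSet hbi ι y₀ := by
  intro hω
  have hcl : ι xk ∈ closure (ι '' F.leaf y₀) := limitSets_subset_closure hι (Or.inl hω)
  obtain ⟨s, hs, ε₁, hε₁, hin, hout⟩ := exists_oneSided hJ hLU hk he hloc hι hxke hcl
  have hsignL : ∀ q : F.Leaf y₀, IsCrossing e (e xk).1 q → |ht e q - (e xk).2| < ε₁ → 0 < s * (ht e q - (e xk).2) :=
    fun q hq hnear ↦ sign_of_isCrossing hk hxke hs hε₁ hout hLU q hq hnear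
  -- a reference crossing
  have hxk : e.symm ((e xk).1, (e xk).2) = xk := e.left_inv hxke
  have hωv : ι (e.symm ((e xk).1, (e xk).2)) ∈ omegaSet hbi ι y₀ := by rw [hxk]; exact hω
  obtain ⟨c₁, hc₁, hc₁ε⟩ := exists_crossing_near₀ (hbi := hbi) he hι hωv hε₁
  have hc₁pos := hsignL c₁ hc₁ hc₁ε
  -- a good height: on the side `s`, below `c₁`, off countably many heights
  set BAD : Set ℝ := F.leafHeights e y₀ ∪ ⋃ v ∈ D.P, ⋃ sl ∈ D.levelLeaves v, F.leafHeights e sl with hBAD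
  have hBADc : BAD.Countable := (F.countable_leafHeights he y₀).union
    (D.P_finite.countable.biUnion fun v _ ↦ (D.finite_levelLeaves v).countable.biUnion fun sl _ ↦ F.countable_leafHeights he sl)
  have hdense : Dense ((fun t ↦ s * (t - (e xk).2)) '' BAD)ᶜ := (hBADc.image _).dense_compl ℝ
  obtain ⟨τ, hτBAD, hτI⟩ := hdense.exists_mem_open isOpen_Ioo (nonempty_Ioo.2 hc₁pos)
  set t : ℝ := (e xk).2 + s * τ with htdef
  have hss : s * s = 1 := by rcases hs with rfl | rfl <;> norm_num
  have hst : s * (t - (e xk).2) = τ := by rw [htdef, add_sub_cancel_left, ← mul_assoc, hss, one_mul]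
  have htBAD : t ∉ BAD := fun h ↦ hτBAD ⟨t, h, hst⟩
  have ht0 : 0 < s * (t - (e xk).2) := by rw [hst]; exact hτI.1
  have ht1 : s * (t - (e xk).2) < s * (ht e c₁ - (e xk).2) := by rw [hst]; exact hτI.2
  have htL : t ∉ F.leafHeights e y₀ := fun h ↦ htBAD (Or.inl h)
  have htA : t ∉ ⋃ v ∈ D.P, ⋃ sl ∈ D.levelLeaves v, F.leafHeights e sl := fun h ↦ htBAD (Or.inr h)
  -- the sack and the zone argument
  obtain ⟨Dk, htI, hwin, hxkR⟩ := exists_sack hbi hι hLU hk he hxke hs hsignL hc₁ hc₁ε ht0 ht1 htL hω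
  exact D.false_of_sack_right hbi hι ho hC hCΩ hJ hγC hsat hcpt hpoly hLU hk he hin Dk hwin htI htL htA
    ⟨ι xk, Or.inl hω, xk, rfl⟩ hxkR

include ho hC hCΩ hJ hγC hsat hcpt hpoly hLU hk he hxke hloc in
/-- **No open leaf inside a terminal zone α-accumulates on a point of the domain on its trace.**
[cite: CamachoLinsNeto1985, Ch. VII §2] -/
theorem not_mem_alphaSet_of_zone : ι xk ∉ alphaSet hbi ι y₀ := by
  intro hα
  have hcl : ι xk ∈ closure (ι '' F.leaf y₀) := limitSets_subset_closure hι (Or.inr hα)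
  obtain ⟨s, hs, ε₁, hε₁, hin, hout⟩ := exists_oneSided hJ hLU hk he hloc hι hxke hcl
  have hsignL : ∀ q : F.Leaf y₀, IsCrossing e (e xk).1 q → |ht e q - (e xk).2| < ε₁ → 0 < s * (ht e q - (e xk).2) :=
    fun q hq hnear ↦ sign_of_isCrossing hk hxke hs hε₁ hout hLU q hq hnear
  have hxk : e.symm ((e xk).1, (e xk).2) = xk := e.left_inv hxke
  have hαv : ι (e.symm ((e xk).1, (e xk).2)) ∈ alphaSet hbi ι y₀ := by rw [hxk]; exact hα
  obtain ⟨c₁, hc₁, hc₁ε⟩ := exists_crossing_near₀_alpha (hbi := hbi) he hι hαv hε₁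
  have hc₁pos := hsignL c₁ hc₁ hc₁ε
  set BAD : Set ℝ := F.leafHeights e y₀ ∪ ⋃ v ∈ D.P, ⋃ sl ∈ D.levelLeaves v, F.leafHeights e sl with hBAD
  have hBADc : BAD.Countable := (F.countable_leafHeights he y₀).union
    (D.P_finite.countable.biUnion fun v _ ↦ (D.finite_levelLeaves v).countable.biUnion fun sl _ ↦ F.countable_leafHeights he sl)
  have hdense : Dense ((fun t ↦ s * (t - (e xk).2)) '' BAD)ᶜ := (hBADc.image _).dense_compl ℝ
  obtain ⟨τ, hτBAD, hτI⟩ := hdense.exists_mem_open isOpen_Ioo (nonempty_Ioo.2 hc₁pos)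
  set t : ℝ := (e xk).2 + s * τ with htdef
  have hss : s * s = 1 := by rcases hs with rfl | rfl <;> norm_num
  have hst : s * (t - (e xk).2) = τ := by rw [htdef, add_sub_cancel_left, ← mul_assoc, hss, one_mul]
  have htBAD : t ∉ BAD := fun h ↦ hτBAD ⟨t, h, hst⟩
  have ht0 : 0 < s * (t - (e xk).2) := by rw [hst]; exact hτI.1
  have ht1 : s * (t - (e xk).2) < s * (ht e c₁ - (e xk).2) := by rw [hst]; exact hτI.2
  have htL : t ∉ F.leafHeights e y₀ := fun h ↦ htBAD (Or.inl h)
  have htA : t ∉ ⋃ v ∈ D.P, ⋃ sl ∈ D.levelLeaves v, F.leafHeights e sl := fun h ↦ htBAD (Or.inr h)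
  obtain ⟨Dk, htI, hwin, hxkL⟩ := exists_sack_alpha hbi hι hLU hk he hxke hs hsignL hc₁ hc₁ε ht0 ht1 htL hα
  exact D.false_of_sack_left hbi hι ho hC hCΩ hJ hγC hsat hcpt hpoly hLU hk he hin Dk hwin htI htL htA
    ⟨ι xk, Or.inr hα, xk, rfl⟩ hxkL


end StarData

end Literature.Topology.PlanarFoliations
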